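import Summits.AnomalousDissipation.AnomalousDissipation.Theorems.BaireTransferRobustLoudUpgradeStubSmallFlowNondeg

/-!
# Stub `stub_segmentNondeg_of` of the line `malkin-cone-group-orbits` (crux stmt-AnomalousDissipation-1144,
# lead c14 reshape "designer segment inside `P_S`"): Riesz–Schauder along the designer segment

Registered stub (curried on two general statements, received as hypotheses):
* `h₁` — Riesz–Schauder finiteness: a compact operator on a real normed space has finitely many eigenvalues of
  modulus `≥ r > 0`;
* `h₂` — reality of kernel vectors: a classical kernel vector of `L(ν,U)` in the mean-zero class, `U` real
  smooth, yields a non-zero REAL classical kernel field `v` (`Torus.LinNSResolventRel ν U 0 (cplx v) 0`).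

CLAIM: for a smooth divergence-free `u₀` of ANY mean, `ν > 0` and `t₁ > 0`, the set of `t ∈ [t₁,t₂]` with
`Torus.IsLinNSEigenvalue ν (t•u₀) 0` is finite.

Proof, on the drifted Fourier lattice of `Literature/Analysis/FluidPDE/SteadyNSLatticePersistence(Drift).lean`
(the assembly `SteadyLatticeDrift.steadyPersistsInLeaf_of_nondeg`, §1–§5, read in reverse):
coefficients `a = 𝓕(complexify ∘ u₀)` (rapidly decaying, transversal, conjugate symmetric, real mean
`M = a 0`); the state space `W` (`SteadyLattice.exists_space`), the bilinear map `B` (`exists_bilinear`), the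
compact drift multiplier `D` of the mean `M` (`SteadyLatticeDrift.exists_drift`), the base point `x₀ ∈ W`
with physical coefficients `a° = update a 0 0`, and the compact linearised convective operator
`K w = B x₀ w + B w x₀` (`isCompactOperator_linearised`), so `D + K` is compact and independent of `t`.
For a bad `t`, `h₂` (with `U = t•u₀`) gives a real kernel field `v ≠ 0`; its coefficients `ĉ = 𝓕(complexify ∘ v)`
solve the Leray-projected lattice equation `LaminarCorner.leray_linearised_eq` for the FULL family
`𝓕(complexify ∘ (t•u₀)) = t • a`, which after `leray_split_drift` reads coordinatewise
`4π²ν X(k) + t ((D X)(k) + (B x₀ X)(k) + (B X x₀)(k)) = 0` for `X = (|k|² ĉ(k))_k ∈ W`, `X ≠ 0`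
(Fourier uniqueness), i.e. `(D + K) X = −(4π²ν/t) X`: `−4π²ν/t` is an eigenvalue of the compact `D + K`.
Since `t ↦ −4π²ν/t` is injective on `t > 0` with modulus `≥ 4π²ν/t₂` on `[t₁,t₂]`, the bad set injects into the
finite set `h₁ (D + K) _ (4π²ν/t₂)`.  Pure proof file (no definitions).

References: R. Temam, *Navier–Stokes Equations* (1979), Ch. II §1; W. Rudin, *Functional Analysis*, Thm. 4.24
(Riesz–Schauder); F. Riesz, B. Sz.-Nagy, *Functional Analysis* §77–78.
-/

-- `Summit.<Summit>.<Problem>` is the tree's mandated summit-side namespace (CONVENTIONS §2); for this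
-- single-conjunct summit the two coincide, so the duplicate is deliberate.
set_option linter.dupNamespace false

noncomputable section

open scoped BigOperators Topology ENNReal NNReal InnerProductSpace ComplexConjugate
open Filter Set Function TopologicalSpace MeasureTheory UnitAddTorus

namespace Summit.AnomalousDissipation.AnomalousDissipation.Theorems.RobustLoudUpgrade.Poly.SegmentNondeg

open Literature.Analysis.FunctionSpaces Literature.Analysis.FunctionSpaces.Torus
open Literature.Analysis.FunctionSpaces.EuclideanSpace
open Literature.Analysis.FluidPDE
open Literature.Analysis.FluidPDE.ScalarFourier
open Literature.Analysis.FluidPDE.SteadyLattice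
open Summit.AnomalousDissipation.AnomalousDissipation.Theses.BaireTransfer
open Summit.AnomalousDissipation.AnomalousDissipation.Theorems.RobustLoudUpgrade

/-! ## §1 A real classical kernel field of `L(ν, t•u₀)` is an eigenvector of `D + K` -/

section Kernel

variable {W : Submodule ℝ (lp (fun _ : Fin 3 → ℤ => EuclideanSpace ℂ (Fin 3)) 2)}

/-- **A real classical kernel field of `L(ν, t•u₀)` is an eigenvector of the lattice operator `D + K` for the
eigenvalue `−4π²ν/t`.**  Here `a = 𝓕(complexify ∘ u₀)` (rapidly decaying), `D` is the drift multiplier of the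
mean `a 0` on the state space `W` (`SteadyLatticeDrift.exists_drift`), `B` the bilinear map of the steady
problem (`SteadyLattice.exists_bilinear`), `x₀ ∈ W` the base point with physical coefficients
`update a 0 0`, and `K w = B x₀ w + B w x₀`.  The kernel equation of `cplx v = complexify ∘ v` is read on the
Fourier side through `LaminarCorner.leray_linearised_eq` (full family `𝓕(complexify ∘ (t•u₀)) = t • a`) and
`LaminarCorner.leray_split_drift`; the eigenvector is `X = (|k|² 𝓕(complexify ∘ v)(k))_k`, non-zero by Fourier
uniqueness. [folklore] -/
theorem exists_eigenvector_of_realKernel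
    (hW : ∀ x : (lp (fun _ : Fin 3 → ℤ => EuclideanSpace ℂ (Fin 3)) 2), x ∈ W ↔ (((x : (Fin 3 → ℤ) →
      (EuclideanSpace ℂ (Fin 3))) : (Fin 3 → ℤ) → EuclideanSpace ℂ (Fin 3)) 0 = 0 ∧ (∀ kk : Fin 3 → ℤ, (∑ jj : Fin 3,
      ((kk jj : ℤ) : ℂ) * (((x : (Fin 3 → ℤ) → (EuclideanSpace ℂ (Fin 3))) : (Fin 3 → ℤ) → EuclideanSpace ℂ (Fin 3)) kk)
      jj) = 0) ∧ IsConjSymm ((x : (Fin 3 → ℤ) → (EuclideanSpace ℂ (Fin 3))) : (Fin 3 → ℤ) → EuclideanSpace ℂ (Fin 3))))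
    {B : W → W → W}
    (hB : ∀ x y : W, (((B x y : W) : (lp (fun _ : Fin 3 → ℤ => EuclideanSpace ℂ (Fin 3)) 2)) : (Fin 3 → ℤ) →
        (EuclideanSpace ℂ (Fin 3))) = fun k =>
      Torus.lerayCoeff k ((WithLp.toLp 2 (fun pp : Fin 3 => transportSym (fun jj mm => (((fun mm : Fin 3 →
          ℤ => (((freqNormSq mm)⁻¹ : ℝ) : ℂ)) • (((x : (lp (fun _ : Fin 3 → ℤ => EuclideanSpace ℂ (Fin 3)) 2)) : (Fin
          3 → ℤ) → (EuclideanSpace ℂ (Fin 3))) : (Fin 3 → ℤ) → EuclideanSpace ℂ (Fin 3)))) mm jj) (fun mm => (((fun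
          mm : Fin 3 → ℤ => (((freqNormSq mm)⁻¹ : ℝ) : ℂ)) • (((y : (lp (fun _ : Fin 3 → ℤ => EuclideanSpace ℂ (Fin
          3)) 2)) : (Fin 3 → ℤ) → (EuclideanSpace ℂ (Fin 3))) : (Fin 3 → ℤ) → EuclideanSpace ℂ (Fin 3)))) mm pp) k) :
          EuclideanSpace ℂ (Fin 3))))
    {a : (Fin 3 → ℤ) → EuclideanSpace ℂ (Fin 3)} (har : RapidDecay a) {D : W →L[ℝ] W}
    (hD : ∀ x : W, (((D x : W) : (lp (fun _ : Fin 3 → ℤ => EuclideanSpace ℂ (Fin 3)) 2)) : (Fin 3 → ℤ) →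
        (EuclideanSpace ℂ (Fin 3))) = fun k =>
      (2 * Real.pi * Complex.I * (∑ jj : Fin 3, ((k jj : ℤ) : ℂ) * (a 0) jj)) • (((fun mm : Fin 3 → ℤ => (((freqNormSq
          mm)⁻¹ : ℝ) : ℂ)) • (((x : (lp (fun _ : Fin 3 → ℤ => EuclideanSpace ℂ (Fin 3)) 2)) : (Fin 3 → ℤ) →
          (EuclideanSpace ℂ (Fin 3))) : (Fin 3 → ℤ) → EuclideanSpace ℂ (Fin 3)))) k)
    {x₀ : W}
    (hcf : ((fun mm : Fin 3 → ℤ => (((freqNormSq mm)⁻¹ : ℝ) : ℂ)) • (((x₀ : (lp (fun _ : Fin 3 → ℤ => EuclideanSpace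
      ℂ (Fin 3)) 2)) : (Fin 3 → ℤ) → (EuclideanSpace ℂ (Fin 3))) : (Fin 3 → ℤ) → EuclideanSpace ℂ (Fin 3))) =
      Function.update a 0 0)
    {K : W →L[ℝ] W} (hKw : ∀ w, K w = B x₀ w + B w x₀)
    {ν t : ℝ} (ht : t ≠ 0) {u₀ : UnitAddTorus (Fin 3) → EuclideanSpace ℝ (Fin 3)} (hu₀ : IsSmooth u₀)
    (ha : mFourierCoeff (complexify ∘ u₀) = a)
    {v : UnitAddTorus (Fin 3) → EuclideanSpace ℝ (Fin 3)} (hv0 : v ≠ 0)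
    (hrel : Torus.LinNSResolventRel ν (fun x => t • u₀ x) 0 (cplx v) 0) :
    ∃ w : W, w ≠ 0 ∧ (D + K) w = (-(4 * Real.pi ^ 2 * ν / t)) • w := by
  -- unpack the classical kernel relation of `cplx v = complexify ∘ v`
  have hcv : cplx v = complexify ∘ v := funext fun x => realToComplex_eq_complexify (v x)
  rw [hcv] at hrel
  obtain ⟨hw, hdivC, hmean, q, hq, hE⟩ := hrel
  have hE' : ∀ x, Torus.linearizedNSOperator ν (fun x => t • u₀ x) (complexify ∘ v) q x = 0 := fun x => by
    have h := hE x
    rwa [zero_smul, sub_zero, Pi.zero_apply] at h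
  have hvs : IsSmooth v := (contDiff_complexify_comp_iff (f := Torus.lift v)).1 hw
  have hU : IsSmooth (fun x => t • u₀ x) := hu₀.smul t
  have ht' : (t : ℂ) ≠ 0 := Complex.ofReal_ne_zero.2 ht
  -- the coefficient family of the kernel field
  obtain ⟨c, hc⟩ : ∃ c, mFourierCoeff (complexify ∘ v) = c := ⟨_, rfl⟩
  have hcr : RapidDecay c := hc ▸ hw.rapidDecay_mFourierCoeff
  have hc0 : c 0 = 0 := hc ▸ mFourierCoeff_zero_of_hasZeroMean hmean
  have hct : ∀ k : Fin 3 → ℤ, (∑ jj : Fin 3, ((k jj : ℤ) : ℂ) * (c k) jj) = 0 := fun k =>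
    hc ▸ KolmogorovShear.kdot_mFourierCoeff_eq_zero hw hdivC k
  have hccs : IsConjSymm c := by
    have h := isConjSymm_mFourierCoeff (d := Fin 3) hvs.integrable
    rw [hc] at h
    exact h
  have hPc : ∀ k, Torus.lerayCoeff k (c k) = c k := fun k => by
    by_cases hk : k = 0
    · rw [hk, hc0, lerayCoeff_zero_vec]
    · exact lerayCoeff_of_kdot_eq_zero hk (hct k)
  -- the coefficients of the base flow `t • u₀` are `t • a`
  have hta : mFourierCoeff (complexify ∘ fun x => t • u₀ x) = (t : ℂ) • a := by
    have e : (complexify ∘ fun x => t • u₀ x : UnitAddTorus (Fin 3) → EuclideanSpace ℂ (Fin 3)) =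
        (t : ℂ) • (complexify ∘ u₀) := by
      funext x
      simp only [Function.comp_apply, Pi.smul_apply, coe_smul_complexify]
    rw [e, ← ha]
    funext k
    exact mFourierCoeff_const_smul (t : ℂ) _ k
  -- the projected lattice equation of the kernel field, drift of the zero mode split off
  have hEq : ∀ k : Fin 3 → ℤ, (((ν * (4 * Real.pi ^ 2 * freqNormSq k)) : ℝ) : ℂ) • c k +
      (t : ℂ) • (Torus.lerayCoeff k ((WithLp.toLp 2 (fun pp : Fin 3 => transportSym
            (fun jj mm => (Function.update a 0 0) mm jj) (fun mm => c mm pp) k) : EuclideanSpace ℂ (Fin 3))) +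
          Torus.lerayCoeff k ((WithLp.toLp 2 (fun pp : Fin 3 => transportSym (fun jj mm => c mm jj)
            (fun mm => (Function.update a 0 0) mm pp) k) : EuclideanSpace ℂ (Fin 3))) +
          (2 * Real.pi * Complex.I * (∑ jj : Fin 3, ((k jj : ℤ) : ℂ) * (a 0) jj)) • c k) = 0 := by
    intro k
    have h := LaminarCorner.leray_linearised_eq hU hw hdivC hmean hq hE' k
    rw [hta, hc, nl_smul_left, nl_smul_right, ← smul_add, lerayCoeff_smul',
      LaminarCorner.leray_split_drift har hcr hPc k] at h
    exact h
  -- the weighted unknown `X = |k|² ĉ` and the corresponding element of `W`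
  obtain ⟨X, hX⟩ : ∃ X : (Fin 3 → ℤ) → EuclideanSpace ℂ (Fin 3), X = fun k => ((freqNormSq k : ℝ) : ℂ) • c k :=
    ⟨_, rfl⟩
  have hXk : ∀ k, X k = ((freqNormSq k : ℝ) : ℂ) • c k := fun k => by rw [hX]
  have hXr : RapidDecay X := by
    refine hcr.of_norm_le_mul_pow (C := 1) (s := 1) fun k => ?_
    rw [hX]
    dsimp only
    rw [norm_smul, Complex.norm_real, Real.norm_of_nonneg (freqNormSq_nonneg k), one_mul, pow_one]
    exact mul_le_mul_of_nonneg_right (by linarith [freqNormSq_nonneg k]) (norm_nonneg _)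
  have hX0 : X 0 = 0 := by rw [hXk, freqNormSq_zero, Complex.ofReal_zero, zero_smul]
  have hXV : ((X : (Fin 3 → ℤ) → EuclideanSpace ℂ (Fin 3)) 0 = 0 ∧ (∀ kk : Fin 3 → ℤ, (∑ jj : Fin 3, ((kk jj : ℤ) :
      ℂ) * ((X : (Fin 3 → ℤ) → EuclideanSpace ℂ (Fin 3)) kk) jj) = 0) ∧ IsConjSymm (X : (Fin 3 → ℤ) → EuclideanSpace
      ℂ (Fin 3))) := by
    refine ⟨hX0, fun k => by rw [hXk, kdot_smul, hct k, mul_zero], fun k => ?_⟩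
    rw [hXk, hXk, freqNormSq_neg, hccs k, conjVec_smul, Complex.conj_ofReal]
  have hcfX : ((fun mm : Fin 3 → ℤ => (((freqNormSq mm)⁻¹ : ℝ) : ℂ)) • X) = c := by
    rw [hX]; exact cf_weight_smul hc0
  obtain ⟨xw, hxwc⟩ : ∃ xw : W, ((xw : (lp (fun _ : Fin 3 → ℤ => EuclideanSpace ℂ (Fin 3)) 2)) : (Fin 3 → ℤ) →
      (EuclideanSpace ℂ (Fin 3))) = X :=
    ⟨⟨⟨X, memℓp_two_of_rapidDecay hXr⟩, (hW _).2 hXV⟩, rfl⟩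
  -- `X ≠ 0`: otherwise `ĉ = 0`, `complexify ∘ v = 0`, `v = 0`
  have hXne : X ≠ 0 := by
    intro hXz
    apply hv0
    have hck : ∀ k, c k = 0 := fun k => by
      by_cases hk : k = 0
      · rw [hk, hc0]
      · have h : ((freqNormSq k : ℝ) : ℂ) • c k = 0 := by rw [← hXk, hXz, Pi.zero_apply]
        have hK : ((freqNormSq k : ℝ) : ℂ) ≠ 0 := by
          exact_mod_cast ne_of_gt (lt_of_lt_of_le one_pos (one_le_freqNormSq' hk))
        exact (smul_eq_zero.1 h).resolve_left hK
    have hw0 : (complexify ∘ v : UnitAddTorus (Fin 3) → EuclideanSpace ℂ (Fin 3)) = 0 :=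
      eq_zero_of_forall_mFourierCoeff_eq_zero hw.continuous fun k => by rw [hc]; exact hck k
    funext x
    refine complexify_injective ?_
    rw [Pi.zero_apply, map_zero]
    exact congrFun hw0 x
  refine ⟨xw, fun hz => hXne ?_, Subtype.ext (lp.ext (funext fun k => ?_))⟩
  · rw [← hxwc, hz, Submodule.coe_zero, lp.coeFn_zero]
  -- the eigen-equation, coordinatewise
  rw [add_apply, coeW_add, hKw, coeW_add, coeW_smul, hB, hB, hD, hcf, hxwc, hcfX]
  simp only [Pi.add_apply, Pi.smul_apply]
  have h2 := (eq_inv_smul_iff₀ ht').2 (eq_neg_of_add_eq_zero_right (hEq k))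
  rw [hXk, ← Complex.coe_smul, smul_smul, add_comm, h2, ← neg_smul, smul_smul]
  congr 1
  push_cast
  ring

end Kernel

/-! ## §2 The registered stub -/

section Main

/-- **Registered stub `stub_segmentNondeg_of`** (Riesz–Schauder along the designer segment, curried on the
general finiteness statement `h₁` and on the reality of kernel vectors `h₂`): for a smooth divergence-free `u₀`
of any mean, `ν > 0` and `t₁ > 0`, only finitely many `t ∈ [t₁,t₂]` make `L(ν, t•u₀)` degenerate in the
mean-zero class.  On the drifted lattice `W`, `L(ν,t•u₀) ↝ 4π²ν·1 + t·(D + K)` with `D + K` compact and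
`t`-independent (`SteadyLatticeDrift.exists_drift`, `SteadyLattice.isCompactOperator_linearised`); a bad `t`
makes `−4π²ν/t` an eigenvalue of `D + K` (`exists_eigenvector_of_realKernel`), and `t ↦ −4π²ν/t` is injective
with modulus `≥ 4π²ν/t₂` on `[t₁,t₂]`. [folklore] -/
theorem stub_segmentNondeg_of :
    (∀ {X : Type} [NormedAddCommGroup X] [NormedSpace ℝ X] (T : X →L[ℝ] X), IsCompactOperator T →
      ∀ r : ℝ, 0 < r → {μ : ℝ | r ≤ |μ| ∧ Module.End.HasEigenvalue (T : Module.End ℝ X) μ}.Finite) →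
    (∀ (ν : ℝ) (U : UnitAddTorus (Fin 3) → EuclideanSpace ℝ (Fin 3)), IsSmooth U → Torus.IsLinNSEigenvalue ν U 0 →
      ∃ v : UnitAddTorus (Fin 3) → EuclideanSpace ℝ (Fin 3), v ≠ 0 ∧ Torus.LinNSResolventRel ν U 0 (cplx v) 0) →
    ∀ (ν : ℝ) (u₀ : UnitAddTorus (Fin 3) → EuclideanSpace ℝ (Fin 3)) (t₁ t₂ : ℝ), 0 < ν → IsSmooth u₀ → IsDivFree u₀ →
      0 < t₁ → {t : ℝ | t ∈ Set.Icc t₁ t₂ ∧ Torus.IsLinNSEigenvalue ν (fun x => t • u₀ x) 0}.Finite := by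
  intro h₁ h₂ ν u₀ t₁ t₂ hν hu₀ hdiv ht₁
  -- §1 the coefficients of `u₀` (full family; the zero mode is the complexified mean, a real vector)
  obtain ⟨a, ha⟩ : ∃ a, mFourierCoeff (complexify ∘ u₀) = a := ⟨_, rfl⟩
  have har : RapidDecay a := ha ▸ hu₀.complexify_comp.rapidDecay_mFourierCoeff
  have hat : ∀ m : Fin 3 → ℤ, (∑ jj : Fin 3, ((m jj : ℤ) : ℂ) * (a m) jj) = 0 := fun m =>
    ha ▸ hdiv.sum_mul_mFourierCoeff_eq_zero hu₀ m
  have hacs : IsConjSymm a := by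
    have h := isConjSymm_mFourierCoeff (d := Fin 3) hu₀.integrable
    rw [ha] at h
    exact h
  have hM : conjVec (a 0) = a 0 := by
    have h := hacs 0
    rw [neg_zero] at h
    exact h.symm
  have hbr : RapidDecay (Function.update a 0 0) := SteadyLatticeDrift.rapidDecay_update har
  -- §2 the state space, the bilinear map, the drift multiplier of the mean
  obtain ⟨W, hW, hWc⟩ := exists_space
  obtain ⟨B, hB, hBb⟩ := exists_bilinear hW
  obtain ⟨D, hD, hDc⟩ := SteadyLatticeDrift.exists_drift hW hWc hM
  -- §3 the base point `x₀` (physical coefficients: the punctured family `update a 0 0`)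
  obtain ⟨X₀, hX₀⟩ : ∃ X₀ : (Fin 3 → ℤ) → EuclideanSpace ℂ (Fin 3),
      X₀ = fun k => ((freqNormSq k : ℝ) : ℂ) • a k := ⟨_, rfl⟩
  have hX₀k : ∀ k, X₀ k = ((freqNormSq k : ℝ) : ℂ) • a k := fun k => by rw [hX₀]
  have hX₀r : RapidDecay X₀ := by
    refine har.of_norm_le_mul_pow (C := 1) (s := 1) fun k => ?_
    rw [hX₀]
    dsimp only
    rw [norm_smul, Complex.norm_real, Real.norm_of_nonneg (freqNormSq_nonneg k), one_mul, pow_one]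
    exact mul_le_mul_of_nonneg_right (by linarith [freqNormSq_nonneg k]) (norm_nonneg _)
  have hX₀0 : X₀ 0 = 0 := by rw [hX₀k, freqNormSq_zero, Complex.ofReal_zero, zero_smul]
  have hX₀V : ((X₀ : (Fin 3 → ℤ) → EuclideanSpace ℂ (Fin 3)) 0 = 0 ∧ (∀ kk : Fin 3 → ℤ, (∑ jj : Fin 3, ((kk jj : ℤ) :
      ℂ) * ((X₀ : (Fin 3 → ℤ) → EuclideanSpace ℂ (Fin 3)) kk) jj) = 0) ∧ IsConjSymm (X₀ : (Fin 3 → ℤ) → EuclideanSpace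
      ℂ (Fin 3))) := by
    refine ⟨hX₀0, fun k => by rw [hX₀k, kdot_smul, hat k, mul_zero], fun k => ?_⟩
    rw [hX₀k, hX₀k, freqNormSq_neg, hacs k, conjVec_smul, Complex.conj_ofReal]
  have hcfX₀ : ((fun mm : Fin 3 → ℤ => (((freqNormSq mm)⁻¹ : ℝ) : ℂ)) • X₀) = Function.update a 0 0 := by
    rw [hX₀]; exact SteadyLatticeDrift.cf_weight_smul' a
  obtain ⟨x₀, hx₀⟩ : ∃ x₀ : W, ((x₀ : (lp (fun _ : Fin 3 → ℤ => EuclideanSpace ℂ (Fin 3)) 2)) : (Fin 3 → ℤ) →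
      (EuclideanSpace ℂ (Fin 3))) = X₀ :=
    ⟨⟨⟨X₀, memℓp_two_of_rapidDecay hX₀r⟩, (hW _).2 hX₀V⟩, rfl⟩
  have hcf : ((fun mm : Fin 3 → ℤ => (((freqNormSq mm)⁻¹ : ℝ) : ℂ)) • (((x₀ : (lp (fun _ : Fin 3 →
      ℤ => EuclideanSpace ℂ (Fin 3)) 2)) : (Fin 3 → ℤ) → (EuclideanSpace ℂ (Fin 3))) : (Fin 3 → ℤ) → EuclideanSpace ℂ
      (Fin 3))) = Function.update a 0 0 := by rw [hx₀]; exact hcfX₀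
  -- §4 the linearised convective operator `K w = B x₀ w + B w x₀`; `D + K` is compact
  obtain ⟨K, hKw⟩ : ∃ K : W →L[ℝ] W, ∀ w, K w = B x₀ w + B w x₀ :=
    ⟨(hBb.deriv (x₀, x₀)).comp ((ContinuousLinearMap.id ℝ W).prod (ContinuousLinearMap.id ℝ W)), fun w => by
      simp [IsBoundedBilinearMap.deriv_apply]⟩
  have hKc : IsCompactOperator K := isCompactOperator_linearised hWc hB x₀ (by rw [hcf]; exact hbr) K hKw
  have hDKc : IsCompactOperator (D + K) := hDc.add hKc
  -- §5 Riesz–Schauder: the bad parameters inject into the eigenvalues of `D + K` of modulus `≥ 4π²ν/t₂`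
  have hc0 : (0 : ℝ) < 4 * Real.pi ^ 2 * ν := by positivity
  by_cases ht₂ : 0 < t₂
  · have hfin := h₁ (D + K) hDKc (4 * Real.pi ^ 2 * ν / t₂) (by positivity)
    refine Set.Finite.of_finite_image (f := fun s : ℝ => -(4 * Real.pi ^ 2 * ν / s)) (hfin.subset ?_) ?_
    · rintro _ ⟨t, ⟨⟨ht1, ht2⟩, heig⟩, rfl⟩
      have ht : 0 < t := lt_of_lt_of_le ht₁ ht1
      refine ⟨?_, ?_⟩
      · show 4 * Real.pi ^ 2 * ν / t₂ ≤ |-(4 * Real.pi ^ 2 * ν / t)|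
        rw [abs_neg, abs_of_pos (div_pos hc0 ht)]
        exact div_le_div_of_nonneg_left hc0.le ht ht2
      · obtain ⟨v, hv0, hrel⟩ := h₂ ν (fun x => t • u₀ x) (hu₀.smul t) heig
        obtain ⟨w, hw0, hw⟩ :=
          exists_eigenvector_of_realKernel hW hB har hD hcf hKw ht.ne' hu₀ ha hv0 hrel
        exact Module.End.hasEigenvalue_of_hasEigenvector
          (Module.End.hasEigenvector_iff.2 ⟨Module.End.mem_eigenspace_iff.2 hw, hw0⟩)
    · rintro t ⟨⟨ht1, -⟩, -⟩ s ⟨⟨hs1, -⟩, -⟩ h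
      have ht : 0 < t := lt_of_lt_of_le ht₁ ht1
      have hs : 0 < s := lt_of_lt_of_le ht₁ hs1
      have h' : 4 * Real.pi ^ 2 * ν / t = 4 * Real.pi ^ 2 * ν / s := neg_inj.1 h
      rw [div_eq_div_iff ht.ne' hs.ne'] at h'
      exact (mul_left_cancel₀ hc0.ne' h').symm
  · refine Set.Finite.subset (Set.finite_empty) ?_
    rintro t ⟨⟨ht1, ht2⟩, -⟩
    exact absurd (lt_of_lt_of_le (lt_of_lt_of_le ht₁ ht1) ht2) ht₂

end Main

end Summit.AnomalousDissipation.AnomalousDissipation.Theorems.RobustLoudUpgrade.Poly.SegmentNondeg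

end
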